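import Summits.AnomalousDissipation.AnomalousDissipation.Theorems.PumpedMirrorMirrorFloorTGSmallEnergy
import Summits.AnomalousDissipation.AnomalousDissipation.Theorems.PumpedMirrorMirrorFloorTGDuality

/-!
# Strategist census, gen 1 / seat b1 — typed first lemmas of the attempted switches
# (crux `PumpedMirror.MirrorFloorTG`, stmt-AnomalousDissipation-15372)

Companion of `Cruxes/MirrorFloorTG/STRATEGY-CENSUS.md` (b1 part). Statements only (`def … : Prop`), no `sorry`:
each is the FIRST LEMMA of a switch examined in the census, typed over tree vocabulary so that a prover / the lead
can pick it up verbatim. None of them is the crux or a restatement of it; the census records why each stops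
short of the crux (headings in brackets).

* `StrainBoundedTest`, `LinearReachFloor` [STRENGTHEN S7 / DECOMPOSITION D8] — the reach of LINEAR certificates:
  for a smooth solenoidal test field `g` with `∫(u⊗u):∇g ≥ −Λ|u|²` on `H`, every relaxed statistic of `NS_ν(f_TG)`
  carried by `{|u|² ≤ E}` obeys `(f_TG, g) − ΛE ≤ ‖∇g‖₂ (ν ε(μ))^{1/2}` — so below `E_lin = sup_g (f_TG,g)/Λ(g)`
  (a tension-only Michell / Beckmann problem for the load `f_TG`; numerically `0.056 ≤ E_lin ≤ 0.123`) the crux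
  holds with a ν-INDEPENDENT linear certificate and the floor is even `≳ (E_lin − E)²/ν`. Provable now (S–M),
  generalises the landed `floor_smallEnergy_uniform` (`g = f_TG`, `Λ = 2π`, reach `1/(8π) ≈ 0.040`).
* `CertificateSingularityLaw` [STRENGTHEN S8 / NEGATION N8] — force-robustness made quantitative: a certificate
  `(Φ₁, θ₁)` valid at `(ν, E, ε₀)` on the mirror slab satisfies, at every smooth solenoidal K-symmetric `v` with
  `∫|v|² ≤ E`, `ε₀ ≤ ν‖∇v‖² + ‖f_TG + νΔv − (v·∇)v‖₂ (‖Φ₁'(v)‖₂ + 2|θ₁|√E)`. Provable now (S). Consequence: if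
  L²-approximate smooth K-dodgers of `f_TG` exist at bounded energy and small dissipation (N8, open, likely), every
  certificate must blow up, `sup_ball ‖Φ₁'‖₂ + |θ₁| → ∞` as `ν → 0` — a necessary singularity, not a kill.
* `EnsembleKelvinPumpTG` [TRANSFER T7 / DECOMPOSITION D7] — the statistical Kelvin pump: NO probability measure on
  `H` carried by uniformly-`C¹` K-symmetric fields annihilates the linear EULER–`f_TG` Liouville functionals
  (`∮_C f_TG·dl = 4/π ≠ 0` on the pinned face loop, while `(div E[u⊗u])_s = ∂_s E[u_s²]/2` along pinned edges).
  Provable now (M); it is the ensemble form of the route's support `NoSmoothMirrorDodgerTG` (Dirac case) and kills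
  exactly the smooth-supported quiet limits — the census explains why quiet limits need not be smooth-supported
  (codimension-2 traces), which is where the transfer breaks.
* `IsRelaxedK`, `EnstrophyBlowupK` (Sub_A), `LargeEnstrophyLoudK` (Sub_B), `mirrorLawsLoudTG_of_dichotomy`,
  `mirrorFloorTG_of_dichotomy` [DECOMPOSITION D7′] — the ENSTROPHY DICHOTOMY, the one typed split found this session in
  which neither piece gives the crux alone: (A) relaxed K-statistics of `f_TG` below `E` have UNBOUNDED mean enstrophy
  as `ν → 0` ("dissipation is super-laminar", strictly between the landed `fixedViscosity_floor` `ε ≥ cν` and S3);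
  (B) relaxed K-statistics of LARGE enstrophy are `ε₀(E)`-loud. Glue `A → B → S3 → MirrorFloorTG` PROVED below
  (kernel-checked, over the landed `mirrorFloorTG_of_mirrorLawsLoudTG`). NOT filed as `route edit --split`: piece B
  carries every imagined quiet enemy (all have `G → ∞`), i.e. the difficulty is undivided (census D7′(d)).
* `StrongCompactnessTransferK` (L1, provable now, M), `H1EulerKelvinRigidityTG` (L2, OPEN), `enstrophyBlowupK_of`
  [D7′, plan for piece A] — A ⇐ L1 + L2, PROVED: a bounded-enstrophy family of relaxed K-statistics along `ν_j → 0`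
  is tight in the STRONG topology of the ball (Markov + Rellich), and its limits are finite-enstrophy K-statistics
  annihilating every cylindrical EULER–`f_TG` Liouville functional (L1); L2 says no such statistic exists. L2's
  enemy is identified in the census: samples with `r^{-1/2}` strain along the symmetry skeleton (enstrophy density
  `≍ 1/dist`, finite) carrying the Kelvin flux — excluded for uniformly-`C¹` samples by `EnsembleKelvinPumpTG`, not for
  `H¹` samples; at the level of LINEAR functionals alone L2 is probably false (rough Gaussian skeleton tubes).
-/

noncomputable section

set_option linter.dupNamespace false

namespace Summit.AnomalousDissipation.AnomalousDissipation.Cruxes.MirrorFloorTG.StrategistCensusB1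

open MeasureTheory Filter Topology UnitAddTorus
open scoped InnerProductSpace RealInnerProductSpace ENNReal NNReal
open Literature.Analysis.FunctionSpaces Literature.Analysis.FunctionSpaces.Torus Literature.Analysis.FluidPDE
open Summit.AnomalousDissipation.AnomalousDissipation.Theses.PumpedMirror
open Summit.AnomalousDissipation.AnomalousDissipation.Theorems.TaylorGreenLoudGalerkinStates.Negative (tgForce)

/-! ## [S7/D8] The reach of linear certificates -/

/-- A **strain-bounded linear test**: a smooth, solenoidal, mean-zero field `g` whose symmetric gradient is bounded
below by `−Λ` as a quadratic form on `H`: `∫ (u⊗u):∇g ≥ −Λ ∫|u|²` for every `u ∈ H` (for smooth `g` this is the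
pointwise matrix inequality `Def g(x) ⪰ −Λ I`). -/
def StrainBoundedTest (g : UnitAddTorus (Fin 3) → EuclideanSpace ℝ (Fin 3)) (Λ : ℝ) : Prop :=
  Torus.IsSmooth g ∧ Torus.IsDivFree g ∧ Torus.HasZeroMean g ∧
    ∀ u : Torus.energySpace (Fin 3), -(Λ * ‖u‖ ^ 2) ≤ Torus.inertialPairing u.1 g

/-- **Linear reach floor** (first lemma of switch S7; provable now). For every strain-bounded linear test `(g, Λ)`
and every relaxed statistic `μ` of `NS_ν(f_TG)` carried by the ball `{|u|² ≤ E}` (probability, finite mean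
enstrophy, cylindrical Liouville identities; NO symmetry and NO energy inequality needed):
`(f_TG, g) − Λ E ≤ ‖∇g‖₂ · (ν ε(μ))^{1/2}`.
Proof sketch: the Liouville identity at the (ball-truncated) linear functional `u ↦ (u,g)` reads
`(f_TG,g) + ν ∫(u,Δg)dμ + ∫ I_g dμ = 0`; `∫ I_g dμ ≥ −ΛE`; `|ν∫(u,Δg)dμ| = ν|(∇ū,∇g)| ≤ ν (E_μ‖∇u‖²)^{1/2}‖∇g‖₂`
(Jensen) `= ‖∇g‖₂ (ν ε(μ))^{1/2}`. Consequences: for `E < (f_TG,g)/Λ` the relaxed class is `((f_TG,g)−ΛE)²/(ν‖∇g‖₂²)`-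
loud, and the crux holds at level `E` with the ν-independent certificate `Φ₁' = g`, `θ₁ = 0`. -/
def LinearReachFloor : Prop :=
  ∀ (g : UnitAddTorus (Fin 3) → EuclideanSpace ℝ (Fin 3)) (Λ : ℝ), StrainBoundedTest g Λ →
    ∀ (ν E : ℝ) (μ : Measure (Torus.energySpace (Fin 3))), 0 < ν → IsProbabilityMeasure μ →
      (∀ᵐ u ∂μ, ‖u‖ ^ 2 ≤ E) → Torus.ensembleEnstrophy μ < ⊤ →
      (∀ Φ : Torus.CylindricalTest (Fin 3),
        Integrable (fun u => Torus.nsGeneratorPairing ν tgForce u (Φ.grad u)) μ ∧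
          ∫ u, Torus.nsGeneratorPairing ν tgForce u (Φ.grad u) ∂μ = 0) →
      (∫ x, ⟪tgForce x, g x⟫_ℝ) - Λ * E ≤
        Real.sqrt (Torus.gradNormSq g) * Real.sqrt (ν * Torus.ensembleDissipation ν μ)

/-- The **linear reach** `E_lin` of the Taylor–Green force as a supremum over strain-bounded tests (dual form of the
tension-only Michell problem `inf {∫ tr τ : τ ⪰ 0, div τ = f_TG + ∇p}`): the statement that some strain-bounded
test certifies level `E`. Numerically (census S7) it holds for `E < 0.056` (explicit `g = f_TG + (P+Q)/6` with the
second-harmonic cells `P, Q`) and fails for `E > 0.123` (explicit smooth psd stress); `g = f_TG` alone gives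
`E < 1/(8π)`. -/
def LinearlyCertifiedLevel (E : ℝ) : Prop :=
  ∃ (g : UnitAddTorus (Fin 3) → EuclideanSpace ℝ (Fin 3)) (Λ : ℝ), StrainBoundedTest g Λ ∧
    Λ * E < ∫ x, ⟪tgForce x, g x⟫_ℝ

/-! ## [S8/N8] Force-robustness of certificates, quantified -/

/-- **Certificate singularity law** (first lemma of switch S8; provable now, pure algebra + Cauchy–Schwarz). If
`(Φ₁, θ₁)` certifies the floor `ε₀` at viscosity `ν` on the K-symmetric finite-enstrophy states of the ball
`{|u|² ≤ E}` (the inner statement of the crux), then at every SMOOTH solenoidal K-symmetric `v` with `∫|v|² ≤ E`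
whose `L²` class is `u`:
`ε₀ ≤ ν‖∇v‖² + ‖R_ν(v)‖₂ (‖Φ₁'(u)‖₂ + 2|θ₁| E^{1/2})`, `R_ν(v) := f_TG + νΔv − (v·∇)v`
(because `⟨F_ν(v), w⟩ = (R_ν(v), w)` for solenoidal `w`, and `(v,f_TG) − ν‖∇v‖² = (v, R_ν(v))`). Hence
`sup ‖Φ₁'‖₂ + 2|θ₁|√E ≥ (ε₀ − ν‖∇v‖²)/‖R_ν(v)‖₂`: certificates are as singular as smooth K-fields are good at
dodging `f_TG` in `L²` at small dissipation. -/
def CertificateSingularityLaw : Prop :=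
  ∀ (ν E ε₀ θ₁ : ℝ) (Φ₁ : Torus.CylindricalTest (Fin 3)), 0 < ν →
    (∀ u : Torus.energySpace (Fin 3),
      (∀ i j : Fin 3, (fun x => (u.1 : UnitAddTorus (Fin 3) → EuclideanSpace ℝ (Fin 3)) (Function.update x i (-x i)) j)
          =ᵐ[volume] (fun x => if j = i then -((u.1 : UnitAddTorus (Fin 3) → EuclideanSpace ℝ (Fin 3)) x j)
            else (u.1 : UnitAddTorus (Fin 3) → EuclideanSpace ℝ (Fin 3)) x j)) →
      Torus.eGradNormSq (u.1 : UnitAddTorus (Fin 3) → EuclideanSpace ℝ (Fin 3)) ≠ ⊤ → ‖u‖ ^ 2 ≤ E →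
      ε₀ ≤ ν * (Torus.eGradNormSq (u.1 : UnitAddTorus (Fin 3) → EuclideanSpace ℝ (Fin 3))).toReal +
        Torus.nsGeneratorPairing ν tgForce u (Φ₁.grad u) +
        2 * θ₁ * (Torus.pairing u.1 tgForce - ν * (Torus.eGradNormSq (u.1 : UnitAddTorus (Fin 3) → EuclideanSpace ℝ (Fin 3))).toReal)) →
    ∀ (v : UnitAddTorus (Fin 3) → EuclideanSpace ℝ (Fin 3)) (u : Torus.energySpace (Fin 3)),
      Torus.IsSmooth v → Torus.IsDivFree v →
      (∀ (i j : Fin 3) (x : UnitAddTorus (Fin 3)), v (Function.update x i (-x i)) j = if j = i then -(v x j) else v x j) →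
      ((u.1 : UnitAddTorus (Fin 3) → EuclideanSpace ℝ (Fin 3)) =ᵐ[volume] v) →
      ∫ x, ‖v x‖ ^ 2 ≤ E →
      ε₀ ≤ ν * Torus.gradNormSq v +
        Real.sqrt (∫ x, ‖tgForce x + ν • Torus.laplacian v x - Torus.convect v v x‖ ^ 2) *
          (Real.sqrt (∫ x, ‖Φ₁.grad u x‖ ^ 2) + 2 * |θ₁| * Real.sqrt E)

/-! ## [T7/D7] The statistical Kelvin pump -/

/-- **Ensemble Kelvin pump for `f_TG`** (first lemma of switch T7; provable now, M). There is NO Borel probability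
measure on `H` which (i) is carried by fields admitting a `C¹`, pointwise K-symmetric, solenoidal representative with
a UNIFORM gradient bound `‖∇v‖_∞ ≤ M`, and (ii) annihilates the linear Euler–`f_TG` Liouville functionals
`u ↦ (f_TG, g) + ∫(u⊗u):∇g` for all smooth solenoidal mean-zero `g` (viscosity `0`). Proof sketch: test with the
mollified face-loop current `g_δ` of `C = ∂([0,½]²×{x₂=0})` (smooth, solenoidal, mean zero); `(f_TG,g_δ) → 4/π`,
while for each admissible `v`, `∫(v⊗v):∇g_δ → −∮_C ((v·∇)v)·dl = −Σ_edges [v_s²/2] = 0` (edges are invariant lines,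
`v_s` vanishes at the pinned corners), uniformly in `v` by the gradient bound: `4/π = 0`. The Dirac case is the
route's support `NoSmoothMirrorDodgerTG`; the census (T7) records why quiet limits of relaxed K-statistics need not
satisfy (i) (no traces on codimension-2 sets for finite-energy/enstrophy laws), which is where the transfer stops. -/
def EnsembleKelvinPumpTG : Prop :=
  ¬ ∃ (μ : Measure (Torus.energySpace (Fin 3))) (M : ℝ), IsProbabilityMeasure μ ∧
    (∀ᵐ u ∂μ, ∃ v : UnitAddTorus (Fin 3) → EuclideanSpace ℝ (Fin 3),
      ((u.1 : UnitAddTorus (Fin 3) → EuclideanSpace ℝ (Fin 3)) =ᵐ[volume] v) ∧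
      ContDiff ℝ 1 (Torus.lift v) ∧ Torus.IsDivFree v ∧ (∀ x, ‖Torus.fderiv v x‖ ≤ M) ∧
      (∀ (i j : Fin 3) (x : UnitAddTorus (Fin 3)), v (Function.update x i (-x i)) j = if j = i then -(v x j) else v x j)) ∧
    (∀ g : UnitAddTorus (Fin 3) → EuclideanSpace ℝ (Fin 3), Torus.IsSmooth g → Torus.IsDivFree g → Torus.HasZeroMean g →
      Integrable (fun u => Torus.nsGeneratorPairing 0 tgForce u g) μ ∧
        ∫ u, Torus.nsGeneratorPairing 0 tgForce u g ∂μ = 0)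


/-! ## [D7′] The enstrophy dichotomy — a typed split with proved glue (not filed; see census) -/

/-- The pinned Taylor–Green force as the route spells it (`f = λ`-form of every item). -/
def IsTG (f : UnitAddTorus (Fin 3) → EuclideanSpace ℝ (Fin 3)) : Prop :=
  f = (fun x => !₂[(fourier 1 (x 0) : ℂ).im * (fourier 1 (x 1) : ℂ).re * (fourier 1 (x 2) : ℂ).re,
    -((fourier 1 (x 0) : ℂ).re * (fourier 1 (x 1) : ℂ).im * (fourier 1 (x 2) : ℂ).re), (0 : ℝ)])

/-- **Relaxed stationary K-statistics of `NS_ν(f)` below energy `E`** — the seven hypotheses of the registered stub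
S3 `stub_mirrorLawsLoudTG`, bundled (probability on `H`; a.s. K-symmetric; a.s. `|u|² ≤ E`; finite mean enstrophy;
every cylindrical Liouville identity with integrable integrand; integrable work; global energy inequality). -/
def IsRelaxedK (ν E : ℝ) (f : UnitAddTorus (Fin 3) → EuclideanSpace ℝ (Fin 3))
    (μ : Measure (Torus.energySpace (Fin 3))) : Prop :=
  IsProbabilityMeasure μ ∧
  (∀ᵐ u ∂μ, ∀ i j : Fin 3,
    (fun x => (u.1 : UnitAddTorus (Fin 3) → EuclideanSpace ℝ (Fin 3)) (Function.update x i (-x i)) j)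
      =ᵐ[volume]
    (fun x => if j = i then -((u.1 : UnitAddTorus (Fin 3) → EuclideanSpace ℝ (Fin 3)) x j)
      else (u.1 : UnitAddTorus (Fin 3) → EuclideanSpace ℝ (Fin 3)) x j)) ∧
  (∀ᵐ u ∂μ, ‖u‖ ^ 2 ≤ E) ∧
  Torus.ensembleEnstrophy μ < ⊤ ∧
  (∀ Φ : Torus.CylindricalTest (Fin 3),
    Integrable (fun u => Torus.nsGeneratorPairing ν f u (Φ.grad u)) μ ∧
      ∫ u, Torus.nsGeneratorPairing ν f u (Φ.grad u) ∂μ = 0) ∧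
  Integrable (fun u : Torus.energySpace (Fin 3) => Torus.pairing u.1 f) μ ∧
  Torus.ensembleDissipation ν μ ≤ ∫ u, Torus.pairing u.1 f ∂μ

/-- The registered stub S3 `stub_mirrorLawsLoudTG` (≡ the crux, `mirrorFloorTG_iff_mirrorLawsLoudTG`), bundled form. -/
def MirrorLawsLoudK : Prop :=
  ∀ f, IsTG f → ∀ E : ℝ, 0 < E → ∃ ε₀ ν₀ : ℝ, 0 < ε₀ ∧ 0 < ν₀ ∧ ∀ ν : ℝ, 0 < ν → ν < ν₀ →
    ∀ μ : Measure (Torus.energySpace (Fin 3)), IsRelaxedK ν E f μ → ε₀ ≤ Torus.ensembleDissipation ν μ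

/-- **Sub_A — ENSTROPHY BLOW-UP of relaxed K-statistics** (new intermediate statement; OPEN; strictly weaker than
S3, strictly stronger than the landed `O(ν)` floor): for `f_TG`, every energy level `E` and every enstrophy budget
`C`, at all sufficiently small `ν` NO relaxed stationary K-statistic below energy `E` has mean enstrophy `≤ C`
("`ε(μ)/ν → ∞` uniformly": dissipation is super-laminar). Kill: a bounded-enstrophy branch of steady K-states of
`NS_ν(f_TG)` along `ν_j → 0` (the in-tree Newton census has `νW ≈ 0.25`, i.e. `W → ∞`: consistent). Plan:
`enstrophyBlowupK_of` below (strong compactness L1, provable + `H¹` Euler–Kelvin rigidity L2, open). -/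
def EnstrophyBlowupK : Prop :=
  ∀ f, IsTG f → ∀ E : ℝ, 0 < E → ∀ C : ℝ, ∃ ν₀ : ℝ, 0 < ν₀ ∧ ∀ ν : ℝ, 0 < ν → ν < ν₀ →
    ∀ μ : Measure (Torus.energySpace (Fin 3)), IsRelaxedK ν E f μ → C < (Torus.ensembleEnstrophy μ).toReal

/-- **Sub_B — LARGE-ENSTROPHY relaxed K-statistics are loud** (OPEN; weaker than S3 — it is S3 restricted to
statistics above some enstrophy threshold `C(E)`; every quiet enemy imagined so far — `ν^{1/3}` edge layers, thin wall
jets, eruption cycles — has `G → ∞`, so this piece keeps the crux's turbulent content undivided). -/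
def LargeEnstrophyLoudK : Prop :=
  ∀ f, IsTG f → ∀ E : ℝ, 0 < E → ∃ ε₀ ν₀ C : ℝ, 0 < ε₀ ∧ 0 < ν₀ ∧ ∀ ν : ℝ, 0 < ν → ν < ν₀ →
    ∀ μ : Measure (Torus.energySpace (Fin 3)), IsRelaxedK ν E f μ →
      C < (Torus.ensembleEnstrophy μ).toReal → ε₀ ≤ Torus.ensembleDissipation ν μ

/-- **Glue of the dichotomy (PROVED): Sub_A → Sub_B → S3.** -/
theorem mirrorLawsLoudK_of_dichotomy (hA : EnstrophyBlowupK) (hB : LargeEnstrophyLoudK) : MirrorLawsLoudK := by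
  intro f hf E hE
  obtain ⟨ε₀, ν₀, C, hε₀, hν₀, hB'⟩ := hB f hf E hE
  obtain ⟨ν₁, hν₁, hA'⟩ := hA f hf E hE C
  refine ⟨ε₀, min ν₀ ν₁, hε₀, lt_min hν₀ hν₁, fun ν hν hνlt μ hμ => ?_⟩
  exact hB' ν hν (hνlt.trans_le (min_le_left _ _)) μ hμ (hA' ν hν (hνlt.trans_le (min_le_right _ _)) μ hμ)

/-- **Sub_A → Sub_B → `MirrorFloorTG` (PROVED)**, over the landed strong duality
`mirrorFloorTG_of_mirrorLawsLoudTG` (p146584): the dichotomy concludes the crux BY NAME. -/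
theorem mirrorFloorTG_of_dichotomy (hA : EnstrophyBlowupK) (hB : LargeEnstrophyLoudK) : MirrorFloorTG := by
  have h := mirrorLawsLoudK_of_dichotomy hA hB
  refine Summit.AnomalousDissipation.AnomalousDissipation.Theorems.PumpedMirrorMirrorFloorTG.mirrorFloorTG_of_mirrorLawsLoudTG ?_
  intro f hf E hE
  obtain ⟨ε₀, ν₀, hε₀, hν₀, hL⟩ := h f hf E hE
  exact ⟨ε₀, ν₀, hε₀, hν₀, fun ν hν hνlt μ hP hsym hball hG hLi hW hEI =>
    hL ν hν hνlt μ ⟨hP, hsym, hball, hG, hLi, hW, hEI⟩⟩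

/-! ### The plan for Sub_A: strong compactness (provable) + `H¹` Euler–Kelvin rigidity (open) -/

/-- **L1 — strong-compactness transfer** (provable now, M; Markov + Rellich tightness on the STRONG ball —
`Torus.isCompact_setOf_eGradNormSq_le`, cf. the landed `stub_sublevelCompactOn` — Prokhorov, continuity of
`u ↦ ⟨F₀(u), Φ'(u)⟩` on the strong ball, `ν_j ∫(u, ΔΦ'(u)) dμ_j → 0`, lower semicontinuity of the mean enstrophy):
a family of relaxed K-statistics of `NS_{ν_j}(f_TG)` below energy `E` with mean enstrophy `≤ C` along `ν_j → 0` has a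
limit point which is a probability measure on `H`, a.s. K-symmetric, a.s. in the ball, of mean enstrophy `≤ C`,
annihilating EVERY cylindrical Euler–`f_TG` Liouville functional (viscosity `0`). -/
def StrongCompactnessTransferK : Prop :=
  ∀ f, IsTG f → ∀ (E C : ℝ) (ν : ℕ → ℝ) (μ : ℕ → Measure (Torus.energySpace (Fin 3))),
    (∀ j, 0 < ν j) → Tendsto ν atTop (𝓝 0) → (∀ j, IsRelaxedK (ν j) E f (μ j)) →
    (∀ j, (Torus.ensembleEnstrophy (μ j)).toReal ≤ C) →
    ∃ μ₀ : Measure (Torus.energySpace (Fin 3)), IsProbabilityMeasure μ₀ ∧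
      (∀ᵐ u ∂μ₀, ∀ i j : Fin 3,
        (fun x => (u.1 : UnitAddTorus (Fin 3) → EuclideanSpace ℝ (Fin 3)) (Function.update x i (-x i)) j)
          =ᵐ[volume]
        (fun x => if j = i then -((u.1 : UnitAddTorus (Fin 3) → EuclideanSpace ℝ (Fin 3)) x j)
          else (u.1 : UnitAddTorus (Fin 3) → EuclideanSpace ℝ (Fin 3)) x j)) ∧
      (∀ᵐ u ∂μ₀, ‖u‖ ^ 2 ≤ E) ∧
      (Torus.ensembleEnstrophy μ₀).toReal ≤ C ∧ Torus.ensembleEnstrophy μ₀ < ⊤ ∧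
      (∀ Φ : Torus.CylindricalTest (Fin 3),
        Integrable (fun u => Torus.nsGeneratorPairing 0 f u (Φ.grad u)) μ₀ ∧
          ∫ u, Torus.nsGeneratorPairing 0 f u (Φ.grad u) ∂μ₀ = 0)

/-- **L2 — `H¹` EULER–KELVIN RIGIDITY for `f_TG`** (OPEN; the heart of Sub_A): there is NO probability measure on
`H`, a.s. K-symmetric, a.s. bounded in energy, of finite mean enstrophy, annihilating every cylindrical
Euler–`f_TG` Liouville functional. Why it might hold: the pinned-loop circulation `∮_C f_TG·dl = 4/π` must be
balanced by `lim_δ E ∫_{T_δ} ρ_δ (u_⊥·∇_⊥)u_s` (normal advection of tangential momentum INTO the skeleton tube at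
every scale `δ`), which vanishes for uniformly-`C¹` samples (`EnsembleKelvinPumpTG`). Why it might fail: `H¹`
samples with `u_⊥ ~ r^{1/2}`, `∇u ~ r^{-1/2}` near the edges (enstrophy density `≍ 1/r`, integrable) carry an `O(1)`
flux; at the level of the LINEAR functionals alone such statistics very likely exist (rough Gaussian tubes on the
skeleton); the nonlinear (flux-type) cylindrical identities are what a construction cannot presently meet and a
proof cannot presently use. -/
def H1EulerKelvinRigidityTG : Prop :=
  ∀ f, IsTG f → ¬ ∃ (μ : Measure (Torus.energySpace (Fin 3))) (E : ℝ), IsProbabilityMeasure μ ∧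
    (∀ᵐ u ∂μ, ∀ i j : Fin 3,
      (fun x => (u.1 : UnitAddTorus (Fin 3) → EuclideanSpace ℝ (Fin 3)) (Function.update x i (-x i)) j)
        =ᵐ[volume]
      (fun x => if j = i then -((u.1 : UnitAddTorus (Fin 3) → EuclideanSpace ℝ (Fin 3)) x j)
        else (u.1 : UnitAddTorus (Fin 3) → EuclideanSpace ℝ (Fin 3)) x j)) ∧
    (∀ᵐ u ∂μ, ‖u‖ ^ 2 ≤ E) ∧ Torus.ensembleEnstrophy μ < ⊤ ∧
    (∀ Φ : Torus.CylindricalTest (Fin 3),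
      Integrable (fun u => Torus.nsGeneratorPairing 0 f u (Φ.grad u)) μ ∧
        ∫ u, Torus.nsGeneratorPairing 0 f u (Φ.grad u) ∂μ = 0)

/-- **Sub_A ⇐ L1 + L2 (PROVED).** If enstrophy did not blow up, some level `E`, budget `C` and viscosities
`ν_j < 1/(j+1)` would carry relaxed K-statistics of mean enstrophy `≤ C`; L1 extracts a finite-enstrophy
Euler-stationary K-statistic in the ball, which L2 forbids. -/
theorem enstrophyBlowupK_of (h1 : StrongCompactnessTransferK) (h2 : H1EulerKelvinRigidityTG) : EnstrophyBlowupK := by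
  intro f hf E hE C
  by_contra hcon
  push Not at hcon
  -- hcon : ∀ ν₀, 0 < ν₀ → ∃ ν, 0 < ν ∧ ν < ν₀ ∧ ∃ μ, IsRelaxedK ν E f μ ∧ (ensembleEnstrophy μ).toReal ≤ C
  choose ν hνpos hνlt μ hμ hC using fun j : ℕ => hcon (1 / ((j : ℝ) + 1)) (by positivity)
  have hlim : Tendsto ν atTop (𝓝 0) := by
    refine squeeze_zero (fun j => (hνpos j).le) (fun j => (hνlt j).le) ?_
    exact tendsto_one_div_add_atTop_nhds_zero_nat
  obtain ⟨μ₀, hP, hsym, hball, -, hG, hL⟩ := h1 f hf E C ν μ hνpos hlim hμ hC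
  exact h2 f hf ⟨μ₀, E, hP, hsym, hball, hG, hL⟩

/-! ## Sanity: the typed statements are well-formed propositions about the crux's objects -/

example : Prop := LinearReachFloor ∧ CertificateSingularityLaw ∧ EnsembleKelvinPumpTG ∧ LinearlyCertifiedLevel (1 / (8 * Real.pi)) ∧
  EnstrophyBlowupK ∧ LargeEnstrophyLoudK ∧ StrongCompactnessTransferK ∧ H1EulerKelvinRigidityTG

end Summit.AnomalousDissipation.AnomalousDissipation.Cruxes.MirrorFloorTG.StrategistCensusB1
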